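/-
Copyright: lit-balaban Phase-2 proof seat p31 (gen 4).  Statement-level skeleton of a published paper; no proof claims beyond what the
kernel checks below.
-/
import Literature.MathematicalPhysics.QuantumFieldTheory.BalabanImbrieJaffe1984to88.BIJ85Eq213Adjoint

/-!
# `BalabanImbrieJaffe1984to88.BIJ85Eq213AdjointExplicit` — T. Bałaban, J. Imbrie, A. Jaffe, *Renormalization of the Higgs model:
minimizers, propagators and the stability of mean field theory*, Commun. Math. Phys. **97** (1985) 299–329 [BalabanImbrieJaffe1985]:
the adjoint `Q*` of the linear bond average (2.13) for (2.14) COMPUTED EXPLICITLY ON EVERY BOND of the tori — *"We do not explicitly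
compute the adjoint Q*"* (p. 304)

statement-level skeleton of published theorems with citation tags; proofs where landed; nothing here is a claim about the Yang–Mills mass gap

PDF held: `paper:balaban1985-cmp97-bij-higgs-minimizers` (journal page = PDF page + 298); p. 304 [PDF 6] re-read this session (text layer;
displays checked against `run/shared/lean/pub/lit-balaban/lit-balaban-r15/pages/1985-cmp97-bij-higgs-minimizers-p006-x2.png` by gens 1–2).

CITATION HEADER (lean-in-tree rule).  Part of the lit-balaban TYPED SKELETON (HOME `run/shared/lean/pub/lit-balaban/`), Phase-2 seat p31
(gen 4); companion of `BIJ85Eq213Adjoint` (p249442; rows **C1.Eq2.13** / **C1.Eq2.14**, fold owner r15, referee ref-5), theorems only.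

THE PRINTED TEXT (verbatim, p. 304 [PDF 6]).  *"(QA)_{b′} = L^{−(d+1)} Σ_{x∈B(b′₋)} Σ_{b∈Γ_{xx′}} A_b, (2.13) … Thus the bonds b which
enter the sum (2.13) range over the interior of the two L-blocks B(b′₋) and B(b′₊), as well as the (surface) bonds connecting these blocks.
The natural inner product on functions on bonds is ⟨A, B⟩_a = Σ_b a^d A_bB_b. (2.14) We do not explicitly compute the adjoint Q*."*

WHAT IS REPRODUCED, and how.  `Q*` = `BIJ85Eq213Adjoint.Qstar` (the (2.14)-adjoint of (2.13) = `LatticeFieldCalculus.bondAvg` on the tori of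
`Balaban1983to89.Setup`, standing range `j + 1 ≤ m + K`).  The count behind (2.13) for an ARBITRARY fine bond `b = ⟨x, x + e_ν⟩`, `x` the
site of `B(y)` with offsets `s` (`x = blockSite y s`): `b` is a bond of the straight contours `[x′, x′ + Le_ν]` of exactly two coarse bonds —
`⟨y, y + e_ν⟩` (the `s_ν + 1` contours issuing from the sites of `B(y)` behind `x` on its line) and `⟨y − e_ν, y⟩` (the `L − 1 − s_ν` contours
issuing from `B(y − e_ν)` that cross the surface and pass `x`) — and of no other (`runBond_eq_blockSite_iff`, `runCount_blockSite`); hence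
**`(Q*B)_{⟨x,x+e_ν⟩} = L^{−1}((s_ν + 1)·B_{⟨y,y+e_ν⟩} + (L − 1 − s_ν)·B_{⟨y−e_ν,y⟩})`** (`Qstar_blockSite`; for every bond via the offset
`(x_ν mod L)` of its source, `Qstar_apply`).  On a surface bond (`s_ν = L − 1`) this is `B_{⟨y,y+e_ν⟩}` (`BIJ85Eq213Adjoint.Qstar_of_mem_Bs`);
summed over the bonds of one contour of `b′` the weights give back `QQ*`'s profile, not needed here.  NOTHING beyond the kernel-checked
statements is asserted.  Unit `lit-balaban-p31` (literature-prover-lit-balaban-p31-g4-0), 2026-08-21.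
-/

open scoped BigOperators

namespace Literature.MathematicalPhysics.QuantumFieldTheory.BalabanImbrieJaffe1984to88.BIJ85Eq213AdjointExplicit

open Literature.MathematicalPhysics.QuantumFieldTheory.Balaban1983to89
open BIJ85Sect2SurfaceAverages LatticeFieldCalculus BIJ85Eq219Proof BIJ85Eq213Adjoint

variable {P : Params} {j : ℕ}

/-! ## 1. Torus bookkeeping -/

/-- `y + e_μ ≠ y` on the tori of the series. [folklore] -/
private theorem shift_ne_self {k : ℕ} (y : Site P k) (μ : Fin P.d) : y.shift μ ≠ y := by
  intro h
  have h1 := congrFun h μ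
  simp only [Site.shift, Function.update_self] at h1
  exact one_ne_zero (add_eq_left.1 h1)

/-- `(y − e_μ) + e_μ = y`. [folklore] -/
private theorem shift_unshift {k : ℕ} (y : Site P k) (μ : Fin P.d) : (y.unshift μ).shift μ = y := by
  funext ν
  by_cases h : ν = μ
  · subst h; simp [Site.shift, Site.unshift]
  · simp [Site.shift, Site.unshift, Function.update_of_ne h]

/-- `y − e_μ` is the unique `y′` with `y′ + e_μ = y`. [folklore] -/
private theorem shift_eq_iff_eq_unshift {k : ℕ} (y y' : Site P k) (μ : Fin P.d) : y'.shift μ = y ↔ y' = y.unshift μ := by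
  constructor
  · rintro rfl
    funext ν
    by_cases h : ν = μ
    · subst h; simp [Site.shift, Site.unshift]
    · simp [Site.shift, Site.unshift, Function.update_of_ne h]
  · rintro rfl
    exact shift_unshift y μ

/-! ## 2. Which contours of (2.13) pass through a given bond -/

/-- kernel geometry of (2.13), arbitrary bond: for `b = ⟨blockSite y s, ν⟩` and `t < L`, the `t`-th bond of the straight contour
`[x′, x′ + Le_μ]` issuing from `x′ = blockSite y′ r ∈ B(y′)` IS `b` iff `μ = ν`, `x′` lies on the line of `b` (`r = s` off `ν`), and EITHER the
contour started in `B(y)` behind `b` (`y′ = y`, `r_ν + t = s_ν`) OR it started in the previous block and crossed the surface (`y′ + e_ν = y`,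
`r_ν + t = s_ν + L`) — *"the bonds b which enter the sum (2.13) range over the interior of the two L-blocks B(b′₋) and B(b′₊), as well as
the (surface) bonds"*. [cite: BalabanImbrieJaffe1985, (2.13) p.304] -/
theorem runBond_eq_blockSite_iff (hj : j + 1 ≤ P.m + P.K) (y y' : Site P (j + 1)) (μ ν : Fin P.d) (r s : Fin P.d → Fin P.L)
    {t : ℕ} (ht : t < P.L) :
    runBond (Site.blockSite y' r) μ t = ⟨Site.blockSite y s, ν⟩ ↔
      μ = ν ∧ (∀ κ, κ ≠ ν → r κ = s κ) ∧
        ((y' = y ∧ (r ν : ℕ) + t = s ν) ∨ (y'.shift ν = y ∧ (r ν : ℕ) + t = s ν + P.L)) := by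
  constructor
  · intro h
    have hμ : μ = ν := congrArg PBond.dir h
    subst hμ
    have hsite : runSite (Site.blockSite y' r) μ t = Site.blockSite y s := congrArg PBond.src h
    have hrμ := (r μ).isLt
    refine ⟨rfl, ?_⟩
    by_cases hlt : (r μ : ℕ) + t < P.L
    · rw [runSite_blockSite_of_lt y' r μ hlt] at hsite
      obtain ⟨hy, heq⟩ := AveragingRT.blockSite_inj hj hsite
      refine ⟨fun κ hκ => ?_, Or.inl ⟨hy, ?_⟩⟩
      · have := congrFun heq κ
        rwa [Function.update_of_ne hκ] at this
      · have := congrArg Fin.val (congrFun heq μ)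
        rwa [Function.update_self] at this
    · rw [runSite_blockSite_of_ge hj y' r μ (by omega) (by omega)] at hsite
      obtain ⟨hy, heq⟩ := AveragingRT.blockSite_inj hj hsite
      refine ⟨fun κ hκ => ?_, Or.inr ⟨hy, ?_⟩⟩
      · have := congrFun heq κ
        rwa [Function.update_of_ne hκ] at this
      · have := congrArg Fin.val (congrFun heq μ)
        rw [Function.update_self] at this
        simp only at this
        omega
  · rintro ⟨rfl, hrs, hcase⟩
    have hrμ := (r μ).isLt
    have hsμ := (s μ).isLt
    rcases hcase with ⟨rfl, ht'⟩ | ⟨rfl, ht'⟩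
    · show (⟨runSite (Site.blockSite y' r) μ t, μ⟩ : PBond P j) = ⟨Site.blockSite y' s, μ⟩
      rw [runSite_blockSite_of_lt y' r μ (by omega)]
      congr 2
      funext κ
      by_cases hκ : κ = μ
      · subst hκ
        rw [Function.update_self]
        exact Fin.ext ht'
      · rw [Function.update_of_ne hκ]
        exact hrs κ hκ
    · show (⟨runSite (Site.blockSite y' r) μ t, μ⟩ : PBond P j) = ⟨Site.blockSite (y'.shift μ) s, μ⟩
      rw [runSite_blockSite_of_ge hj y' r μ (by omega) (by omega)]
      congr 2
      funext κ
      by_cases hκ : κ = μ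
      · subst hκ
        rw [Function.update_self]
        exact Fin.ext (by simp only; omega)
      · rw [Function.update_of_ne hκ]
        exact hrs κ hκ

open Classical in
/-- kernel: so a contour of `⟨y′, y′ + e_μ⟩` issuing from `blockSite y′ r` contains `b = ⟨blockSite y s, ν⟩` at most once, namely iff
`μ = ν`, `r = s` off `ν`, and (`y′ = y`, `r_ν ≤ s_ν`) or (`y′ + e_ν = y`, `r_ν ≥ s_ν + 1`). [cite: BalabanImbrieJaffe1985, (2.13) p.304] -/
theorem sum_ite_runBond_blockSite (hj : j + 1 ≤ P.m + P.K) (y y' : Site P (j + 1)) (μ ν : Fin P.d) (r s : Fin P.d → Fin P.L) :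
    (∑ t ∈ Finset.range P.L, if runBond (Site.blockSite y' r) μ t = ⟨Site.blockSite y s, ν⟩ then 1 else 0 : ℕ)
      = if μ = ν ∧ (∀ κ, κ ≠ ν → r κ = s κ) ∧
          ((y' = y ∧ (r ν : ℕ) ≤ s ν) ∨ (y'.shift ν = y ∧ (s ν : ℕ) + 1 ≤ r ν)) then 1 else 0 := by
  have hrν := (r ν).isLt
  have hsν := (s ν).isLt
  by_cases hcond : μ = ν ∧ (∀ κ, κ ≠ ν → r κ = s κ) ∧ ((y' = y ∧ (r ν : ℕ) ≤ s ν) ∨ (y'.shift ν = y ∧ (s ν : ℕ) + 1 ≤ r ν))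
  · rw [if_pos hcond]
    obtain ⟨hμ, hrs, hcase⟩ := hcond
    -- the unique parameter `t₀` of the contour at which it passes `b`
    obtain ⟨t₀, ht₀L, ht₀⟩ : ∃ t₀, t₀ < P.L ∧ ∀ t, t < P.L →
        (runBond (Site.blockSite y' r) μ t = ⟨Site.blockSite y s, ν⟩ ↔ t = t₀) := by
      rcases hcase with ⟨hy, hle⟩ | ⟨hy, hle⟩
      · refine ⟨(s ν : ℕ) - r ν, by omega, fun t ht => ?_⟩
        rw [runBond_eq_blockSite_iff hj y y' μ ν r s ht]
        constructor
        · rintro ⟨-, -, ⟨-, h⟩ | ⟨h, -⟩⟩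
          · omega
          · exact absurd h (hy ▸ shift_ne_self y ν)
        · intro h
          exact ⟨hμ, hrs, Or.inl ⟨hy, by omega⟩⟩
      · refine ⟨(s ν : ℕ) + P.L - r ν, by omega, fun t ht => ?_⟩
        rw [runBond_eq_blockSite_iff hj y y' μ ν r s ht]
        constructor
        · rintro ⟨-, -, ⟨h, -⟩ | ⟨-, h⟩⟩
          · exact absurd hy (h ▸ shift_ne_self y ν)
          · omega
        · intro h
          exact ⟨hμ, hrs, Or.inr ⟨hy, by omega⟩⟩
    rw [Finset.sum_eq_single t₀]
    · rw [if_pos ((ht₀ t₀ ht₀L).2 rfl)]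
    · intro t ht hne
      rw [if_neg fun h => hne ((ht₀ t (Finset.mem_range.1 ht)).1 h)]
    · intro h
      exact absurd (Finset.mem_range.2 ht₀L) h
  · rw [if_neg hcond]
    refine Finset.sum_eq_zero fun t ht => ?_
    rw [if_neg]
    intro h
    have htL := Finset.mem_range.1 ht
    obtain ⟨hμ, hrs, hcase⟩ := (runBond_eq_blockSite_iff hj y y' μ ν r s htL).1 h
    exact hcond ⟨hμ, hrs, hcase.imp (fun h' => ⟨h'.1, by omega⟩) (fun h' => ⟨h'.1, by omega⟩)⟩

/-- counting the sites of a block on one line: `#{r : r = s off ν, p(r_ν)} = #{v : p v}`. [folklore] -/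
private theorem card_filter_line (s : Fin P.d → Fin P.L) (ν : Fin P.d) (p : Fin P.L → Prop) [DecidablePred p] :
    (Finset.univ.filter fun r : Fin P.d → Fin P.L => (∀ κ, κ ≠ ν → r κ = s κ) ∧ p (r ν)).card
      = (Finset.univ.filter p).card := by
  classical
  have hset : (Finset.univ.filter fun r : Fin P.d → Fin P.L => (∀ κ, κ ≠ ν → r κ = s κ) ∧ p (r ν))
      = Fintype.piFinset fun κ => if κ = ν then Finset.univ.filter p else {s κ} := by
    ext r
    simp only [Finset.mem_filter, Finset.mem_univ, true_and, Fintype.mem_piFinset]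
    constructor
    · rintro ⟨h, hp⟩ κ
      by_cases hκ : κ = ν
      · subst hκ; rw [if_pos rfl, Finset.mem_filter]; exact ⟨Finset.mem_univ _, hp⟩
      · rw [if_neg hκ, Finset.mem_singleton]; exact h κ hκ
    · intro h
      refine ⟨fun κ hκ => ?_, ?_⟩
      · have := h κ
        rwa [if_neg hκ, Finset.mem_singleton] at this
      · have := h ν
        rw [if_pos rfl, Finset.mem_filter] at this
        exact this.2
  rw [hset, Fintype.card_piFinset, ← Finset.mul_prod_erase Finset.univ _ (Finset.mem_univ ν), if_pos rfl,
    Finset.prod_congr rfl fun κ hκ => by rw [if_neg (Finset.ne_of_mem_erase hκ), Finset.card_singleton],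
    Finset.prod_const_one, mul_one]

/-- `#{v ∈ {0,…,L−1} : v ≤ a} = a + 1`. [folklore] -/
private theorem card_filter_val_le (a : Fin P.L) :
    (Finset.univ.filter fun v : Fin P.L => (v : ℕ) ≤ a).card = (a : ℕ) + 1 := by
  have h : (Finset.univ.filter fun v : Fin P.L => (v : ℕ) ≤ a) = Finset.Iic a := by
    ext v
    simp only [Finset.mem_filter, Finset.mem_univ, true_and, Finset.mem_Iic, Fin.le_def]
  rw [h, Fin.card_Iic]

/-- `#{v ∈ {0,…,L−1} : a + 1 ≤ v} = L − 1 − a`. [folklore] -/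
private theorem card_filter_succ_le (a : Fin P.L) :
    (Finset.univ.filter fun v : Fin P.L => (a : ℕ) + 1 ≤ v).card = P.L - 1 - a := by
  have h : (Finset.univ.filter fun v : Fin P.L => (a : ℕ) + 1 ≤ v) = Finset.Ioi a := by
    ext v
    simp only [Finset.mem_filter, Finset.mem_univ, true_and, Finset.mem_Ioi, Fin.lt_def, Nat.add_one_le_iff]
  rw [h, Fin.card_Ioi]

open Classical in
/-- **The multiplicities of an arbitrary bond in (2.13)**: `b = ⟨blockSite y s, ν⟩` occurs `s_ν + 1` times in the double sum (2.13) for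
`⟨y, y + e_ν⟩`, `L − 1 − s_ν` times for `⟨y − e_ν, y⟩`, and not at all for any other coarse bond. [cite: BalabanImbrieJaffe1985, (2.13) p.304] -/
theorem runCount_blockSite (hj : j + 1 ≤ P.m + P.K) (y : Site P (j + 1)) (s : Fin P.d → Fin P.L) (ν : Fin P.d) (c : PBond P (j + 1)) :
    runCount c ⟨Site.blockSite y s, ν⟩ =
      if c = ⟨y, ν⟩ then (s ν : ℕ) + 1 else if c = ⟨y.unshift ν, ν⟩ then P.L - 1 - s ν else 0 := by
  obtain ⟨y', μ⟩ := c
  unfold runCount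
  simp_rw [sum_ite_runBond_blockSite hj y y' μ ν _ s]
  rw [Finset.sum_boole, Nat.cast_id]
  by_cases hμ : μ = ν
  · subst hμ
    by_cases hy : y' = y
    · subst hy
      rw [if_pos rfl, ← card_filter_val_le (s μ)]
      have hns : ¬ y'.shift μ = y' := shift_ne_self y' μ
      convert card_filter_line s μ (fun v : Fin P.L => (v : ℕ) ≤ s μ) using 2
      ext r
      simp only [Finset.mem_filter, Finset.mem_univ, true_and, hns, false_and, or_false]
    · have hne : (⟨y', μ⟩ : PBond P (j + 1)) ≠ ⟨y, μ⟩ := fun h => hy (congrArg PBond.src h)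
      rw [if_neg hne]
      by_cases hy' : y'.shift μ = y
      · have hc : (⟨y', μ⟩ : PBond P (j + 1)) = ⟨y.unshift μ, μ⟩ := by
          rw [(shift_eq_iff_eq_unshift y y' μ).1 hy']
        rw [if_pos hc, ← card_filter_succ_le (s μ)]
        convert card_filter_line s μ (fun v : Fin P.L => (s μ : ℕ) + 1 ≤ v) using 2
        ext r
        simp only [Finset.mem_filter, Finset.mem_univ, true_and, hy, false_and, false_or, hy']
      · have hc : (⟨y', μ⟩ : PBond P (j + 1)) ≠ ⟨y.unshift μ, μ⟩ := fun h =>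
          hy' ((shift_eq_iff_eq_unshift y y' μ).2 (congrArg PBond.src h))
        rw [if_neg hc, Finset.card_eq_zero, Finset.filter_eq_empty_iff]
        intro r _
        simp only [hy, hy', false_and, or_self, and_false, not_false_eq_true]
  · have h1 : (⟨y', μ⟩ : PBond P (j + 1)) ≠ ⟨y, ν⟩ := fun h => hμ (congrArg PBond.dir h)
    have h2 : (⟨y', μ⟩ : PBond P (j + 1)) ≠ ⟨y.unshift ν, ν⟩ := fun h => hμ (congrArg PBond.dir h)
    rw [if_neg h1, if_neg h2, Finset.card_eq_zero, Finset.filter_eq_empty_iff]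
    intro r _
    simp only [hμ, false_and, not_false_eq_true]

/-! ## 3. The explicit formula for `Q*` -/

/-- **`Q*` COMPUTED EXPLICITLY** (what p. 304 declines to do: *"We do not explicitly compute the adjoint Q*"*): for the fine bond
`b = ⟨x, x + e_ν⟩` with `x = blockSite y s ∈ B(y)`,
`(Q*B)_b = L^{−1}·((s_ν + 1)·B_{⟨y, y+e_ν⟩} + (L − 1 − s_ν)·B_{⟨y−e_ν, y⟩})` — the two coarse bonds whose contours (2.13) pass through `b`,
weighted by the number of such contours (`runCount_blockSite`) times `L^d·L^{−(d+1)}`. [cite: BalabanImbrieJaffe1985, (2.14) p.304] -/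
theorem Qstar_blockSite (hj : j + 1 ≤ P.m + P.K) (B : PBond P (j + 1) → ℝ) (y : Site P (j + 1)) (s : Fin P.d → Fin P.L)
    (ν : Fin P.d) :
    Qstar B ⟨Site.blockSite y s, ν⟩ =
      (P.L : ℝ)⁻¹ * ((((s ν : ℕ) : ℝ) + 1) * B ⟨y, ν⟩ + ((P.L : ℝ) - 1 - ((s ν : ℕ) : ℝ)) * B ⟨y.unshift ν, ν⟩) := by
  classical
  have hL : (P.L : ℝ) ≠ 0 := Nat.cast_ne_zero.mpr P.L_pos.ne'
  have hsν := (s ν).isLt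
  have hne : (⟨y.unshift ν, ν⟩ : PBond P (j + 1)) ≠ ⟨y, ν⟩ := fun h =>
    shift_ne_self y ν (((shift_eq_iff_eq_unshift y y ν).2 (congrArg PBond.src h).symm))
  unfold Qstar qKer
  rw [← Finset.add_sum_erase Finset.univ _ (Finset.mem_univ (⟨y, ν⟩ : PBond P (j + 1))),
    ← Finset.add_sum_erase _ _ (Finset.mem_erase.2 ⟨hne, Finset.mem_univ _⟩),
    Finset.sum_eq_zero fun c hc => by
      obtain ⟨hc1, hc2⟩ := Finset.mem_erase.1 hc
      rw [runCount_blockSite hj y s ν c, if_neg (Finset.ne_of_mem_erase hc2), if_neg hc1]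
      simp,
    runCount_blockSite hj y s ν, runCount_blockSite hj y s ν, if_pos rfl, if_neg hne, if_pos rfl, add_zero, pow_succ,
    Nat.cast_sub (by omega), Nat.cast_sub (by omega)]
  push_cast
  field_simp

/-- The offsets of a fine site inside its block are its labels `mod L` (`Site.blockEquiv`): `x = blockSite (blockOf x) (x mod L)`. [folklore] -/
private theorem blockSite_mod (hj : j + 1 ≤ P.m + P.K) (x : Site P j) :
    Site.blockSite (blockOf x) (fun ν => ⟨(x ν).val % P.L, Nat.mod_lt _ P.L_pos⟩) = x :=
  congrArg Subtype.val ((Site.blockEquiv hj (blockOf x)).symm_apply_apply ⟨x, rfl⟩)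

/-- **`Q*` ON EVERY BOND**: `(Q*B)_b = L^{−1}·((o + 1)·B_{⟨y, y+e_ν⟩} + (L − 1 − o)·B_{⟨y−e_ν, y⟩})` with `y` the block label of `b₋`, `ν` the
direction of `b`, and `o = (b₋)_ν mod L` the position of `b₋` in its block along `ν`. [cite: BalabanImbrieJaffe1985, (2.14) p.304] -/
theorem Qstar_apply (hj : j + 1 ≤ P.m + P.K) (B : PBond P (j + 1) → ℝ) (b : PBond P j) :
    Qstar B b = (P.L : ℝ)⁻¹ *
      ((((b.src b.dir).val % P.L : ℕ) + 1 : ℝ) * B ⟨blockOf b.src, b.dir⟩ +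
        ((P.L : ℝ) - 1 - ((b.src b.dir).val % P.L : ℕ)) * B ⟨(blockOf b.src).unshift b.dir, b.dir⟩) := by
  obtain ⟨x, ν⟩ := b
  have h := Qstar_blockSite hj B (blockOf x) (fun κ => ⟨(x κ).val % P.L, Nat.mod_lt _ P.L_pos⟩) ν
  rw [blockSite_mod hj x] at h
  exact h

end Literature.MathematicalPhysics.QuantumFieldTheory.BalabanImbrieJaffe1984to88.BIJ85Eq213AdjointExplicit
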